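import Summits.QuantumFields.BalabanUV.Beta.EriceRemainderEnclosureHistoryAutonomyExistence

/-!
# EriceRemainderEnclosureHistoryAutonomyThresholdModulusWitness — (E47b) THE TWO-TERM MODULUS IS EXACT IN BOTH REGIMES: a one-parameter MARKOV
# kink family `κ_q(u) = 2 + 6q·(1 − √3·u₀)₊` on ]0,1]^ℕ (`q ∈ [0,1]`; floor `2`, zeroth moment `6√3·q`, box `γ = 1`, so `bγ² = 2` and the ratio
# `M·γ∕(3√3·b)` IS `q`) whose box solutions from the pins `1` and `p ∈ [1∕2, 1[` differ AT SCALE 1 by at least `(1∕p² − 1)∕(68(1−q))` in the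
# Lipschitz regime `1∕p² − 1 ≤ 9(1−q)²`, by at least `√(1∕p² − 1)∕20` in the Hölder regime `9(1−q)² ≤ 1∕p² − 1`, and by at least `√(1∕p² − 1)∕10`
# AT the threshold `q = 1` — against (E47a)'s upper bounds `(1∕p² − 1)∕(2(1−q))` ((E38b)) and `√((1∕p² − 1)∕(2q))` for these instances: the
# Lipschitz constant's blow-up `1∕(1−q)`, the crossover at `1∕p² − 1 ≍ (1−q)²`, and the exponent `1∕2` at the endpoint are all EXACT; at `q = 1`
# NO Lipschitz bound holds (and, (E47c) `…ThresholdModulusExact`, no bound `K·(1∕p² − 1)^α` with any `α > 1∕2`)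

Cell `pub-balaban`, β-function sub-cell, BINDER row D4 «RemainderConst leaves for Bałaban's split» (`HOME/BINDER-OWNERS.md`; owner lineage `b2b-balaban-beta-an4`;
this file by co-owner #2 lineage `b2b-balaban-beta-d4-p2`, generation 42), β-FLOW TEAM duty (1), FREEZE (0) honoured (def-free: the family is an explicit lambda
in every statement, no declaration, no notation; node U2's `MemFlow` ∕ `SeqBox`, (E40)'s `exists_memFlow_zm` BY NAME).  Companion of (E47a)
`…HistoryAutonomyThresholdModulus` (the two-term modulus `(1−q)Δ + qΔ²∕γ ≤ F` on the closed range; NOT imported — this file is self-contained below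
(E40), and states the family's two-sided forcing inequality itself); cousins: (E38c) `…ThresholdWitness` (a tent at the same corner `1∕√3` of the
window, TWO solutions above the threshold), (E45a) `…AntitoneWitness` (a clamp, a CONTINUUM above the threshold).  Here the functional stays ON the closed
range `q ≤ 1` (one solution per pin) and the corner is a FOLD of the scale-1 step equation at `q = 1`: `3∕s² + 6s − 9 = 3(1−s)²(1+2s)∕s²` in `s = √3·h(1)`.

HONEST FRAMING (page 1, verbatim and binding).  *"Discharging BetaPertH makes Bałaban's UV stability UNCONDITIONAL — a real constructive-QFT result; it is
NOT the continuum limit and NOT the Clay problem."*  THIS FILE DISCHARGES NOTHING OF THE KIND.  A kernel TOY family of Markov functionals on ]0,1] and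
elementary real analysis; whether Bałaban's limit functional is Markov, which constants it has and on which side of the threshold it sits is NOT PRINTED
([I] p. 298) and not asserted.  Row D4 class UNCHANGED (critical-path width 0; instance 0∕1; D4 DISCHARGE NO DATE).  HONEST DEPENDENCY: continuum YM on
T⁴ ⇐ BetaPertH ∧ nine spine estimates (0/9 proved); BetaPertH ⇐ (D1) ∧ (D4) ∧ CAP+tail; G-an2-4 gates asym, D1 and NE2/3/4.

THE WITNESS.  `γ = 1`, `b = 2`, functional `u ↦ 2 + 6q·max(1 − √3·u 0, 0)`: floor `2`, ceiling `2 + 6q`, Markov Lipschitz ∕ zeroth moment `6√3·q`, so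
`M·γ∕(3√3·b) = q` (§1).  For a box solution `h` from the pin `p ∈ ]0,1]` the scale-1 step equation reads, in `s = √3·h(1) ∈ ]0,1]` (the window),
`3∕s² = 1∕p² + 2 + 6q(1 − s)`, i.e. with the forcing `P = 1∕p² − 1` and `t = 1 − s`:  `P = 3∕(1−t)² − 3 − 6q·t = 6(1−q)·t + 9t² + 3t³(4−3t)∕(1−t)²` (§2).
Pin `1` (`P = 0`): `(1−s)²(1+2s) ≤ 0`-type absorption forces `s = 1` — EVERY box solution has `h(1) = 1∕√3`, the corner of the window (§3; at `q = 1` the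
root is DOUBLE: a fold).  Pin `p ∈ [1∕2,1[`: `t ≤ 1∕2` and the two-sided inequality `6(1−q)t + 9t² ≤ P ≤ 6(1−q)t + 33t²` (§4 `forcing_ge` ∕ `forcing_le`)
pins `t = √3·(h(1) − h′(1))` in both regimes (§5).  Existence of the solutions: (E40) `exists_memFlow_zm` (§1 `exists_solution`); their uniqueness
((E38a), `q ≤ 1`) is not used.

WHAT IS PROVED ([folklore]; 0 `def`, 0 sorry).  §1 `two_le_kink`, `abs_kink_sub_le`, `zerothMoment_kink`, `kink_ratio`, `kink_closed_iff`,
`exists_solution`.  §2 `step_one`, `sqrt3_mul_le_one`, `scaled_step`.  §3 **`sqrt3_mul_eq_one_of_pin_one`**, `apply_one_eq_of_pin_one`.  §4 `half_le_sqrt3_mul`,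
**`forcing_ge`**, **`forcing_le`**, `sqrt3_mul_sub_eq`.  §5 ENDs: **`gap_lipschitz_regime`** (`(1∕p² − 1)∕(68(1−q)) ≤ h(1) − h′(1)`), **`gap_hoelder_regime`**
(`√(1∕p² − 1)∕20 ≤ h(1) − h′(1)`), **`gap_at_threshold`** (`√(1∕p² − 1)∕10 ≤ h(1) − h′(1)`), `pin_of_forcing`, **`not_lipschitz_at_threshold`**
(`∀ L ∃ p ∈ [1∕2,1[` and box solutions with `h(1) − h′(1) > L·(1∕p² − 1)`).
-/

noncomputable section
open Filter Topology Finset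

namespace Summit.QuantumFields.BalabanUV.Beta.EriceRemainderEnclosureHistoryAutonomyThresholdModulusWitness

open Literature.MathematicalPhysics.QuantumFieldTheory.Balaban1983to89
open Literature.MathematicalPhysics.QuantumFieldTheory.Balaban1983to89.T4BetaStationary
open Literature.MathematicalPhysics.QuantumFieldTheory.Balaban1983to89.T4BetaFlowWellPosed
open Summit.QuantumFields.BalabanUV.Beta.EriceRemainderEnclosureHistoryAutonomyExistence (exists_memFlow_zm)

variable {q p : ℝ} {h h' : ℕ → ℝ}

/-! ## §1 The kink functional: floor, ceiling, zeroth moment, ratio, existence of solutions -/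

/-- FLOOR `2`. [folklore] -/
theorem two_le_kink (hq : 0 ≤ q) (u : ℕ → ℝ) : 2 ≤ 2 + 6 * q * max (1 - Real.sqrt 3 * u 0) 0 :=
  le_add_of_nonneg_right (mul_nonneg (by positivity) (le_max_right _ _))

/-- MARKOV LIPSCHITZ CONSTANT ∕ ZEROTH MOMENT `6√3·q`: `|κ_q u − κ_q u′| ≤ 6√3·q·D` whenever `|u 0 − u′ 0| ≤ D`. [folklore] -/
theorem abs_kink_sub_le (hq : 0 ≤ q) (u u' : ℕ → ℝ) {D : ℝ} (hD : |u 0 - u' 0| ≤ D) :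
    |(2 + 6 * q * max (1 - Real.sqrt 3 * u 0) 0) - (2 + 6 * q * max (1 - Real.sqrt 3 * u' 0) 0)| ≤ 6 * Real.sqrt 3 * q * D := by
  have h1 : |max (1 - Real.sqrt 3 * u 0) 0 - max (1 - Real.sqrt 3 * u' 0) 0| ≤ Real.sqrt 3 * |u 0 - u' 0| := by
    refine (abs_max_sub_max_le_abs _ _ _).trans ?_
    rw [show (1 - Real.sqrt 3 * u 0) - (1 - Real.sqrt 3 * u' 0) = -(Real.sqrt 3 * (u 0 - u' 0)) by ring, abs_neg, abs_mul,
      abs_of_nonneg (Real.sqrt_nonneg 3)]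
  rw [show (2 + 6 * q * max (1 - Real.sqrt 3 * u 0) 0) - (2 + 6 * q * max (1 - Real.sqrt 3 * u' 0) 0)
      = 6 * q * (max (1 - Real.sqrt 3 * u 0) 0 - max (1 - Real.sqrt 3 * u' 0) 0) by ring, abs_mul,
    abs_of_nonneg (by positivity : (0 : ℝ) ≤ 6 * q)]
  calc 6 * q * |max (1 - Real.sqrt 3 * u 0) 0 - max (1 - Real.sqrt 3 * u' 0) 0|
      ≤ 6 * q * (Real.sqrt 3 * |u 0 - u' 0|) := mul_le_mul_of_nonneg_left h1 (by positivity)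
    _ ≤ 6 * q * (Real.sqrt 3 * D) :=
        mul_le_mul_of_nonneg_left (mul_le_mul_of_nonneg_left hD (Real.sqrt_nonneg 3)) (by positivity)
    _ = 6 * Real.sqrt 3 * q * D := by ring

/-- The zeroth-moment binder shape of (E37b)∕(E38a)∕(E40) for the kink functional, with `M = 6√3·q`. [folklore] -/
theorem zerothMoment_kink (hq : 0 ≤ q) :
    ∀ u u' : ℕ → ℝ, SeqBox 1 u → SeqBox 1 u' → ∀ D : ℝ, (∀ j, |u j - u' j| ≤ D) →
      |(2 + 6 * q * max (1 - Real.sqrt 3 * u 0) 0) - (2 + 6 * q * max (1 - Real.sqrt 3 * u' 0) 0)| ≤ 6 * Real.sqrt 3 * q * D :=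
  fun u u' _ _ _ hD => abs_kink_sub_le hq u u' (hD 0)

/-- THE RATIO IS `q`: `M·γ∕(3√3·b) = 6√3·q·1∕(3√3·2) = q`. [folklore] -/
theorem kink_ratio (q : ℝ) : 6 * Real.sqrt 3 * q * 1 / (3 * Real.sqrt 3 * 2) = q := by
  have : (0 : ℝ) < Real.sqrt 3 := Real.sqrt_pos.2 (by norm_num)
  field_simp
  ring

/-- The CLOSED condition `M·γ ≤ 3√3·b` of (E38a) holds iff `q ≤ 1`. [folklore] -/
theorem kink_closed_iff (q : ℝ) : 6 * Real.sqrt 3 * q * 1 ≤ 3 * Real.sqrt 3 * 2 ↔ q ≤ 1 := by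
  have : (0 : ℝ) < Real.sqrt 3 := Real.sqrt_pos.2 (by norm_num)
  constructor <;> intro hle <;> nlinarith

/-- EXISTENCE of a box solution from every pin `p ∈ ]0,1]`, by (E40) `exists_memFlow_zm` (Schauder; `q ≥ 0`, any size). [folklore] -/
theorem exists_solution (hq : 0 ≤ q) (hp0 : 0 < p) (hp1 : p ≤ 1) :
    ∃ h : ℕ → ℝ, SeqBox 1 h ∧ MemFlow (fun u : ℕ → ℝ => 2 + 6 * q * max (1 - Real.sqrt 3 * u 0) 0) p h :=
  exists_memFlow_zm (γ := 1) (b := 2) (M := 6 * Real.sqrt 3 * q) (zerothMoment_kink hq) (by positivity) hp0 hp1 two_pos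
    (fun u _ => two_le_kink hq u)

/-! ## §2 The scale-1 step equation in the window -/

/-- THE STEP EQUATION AT SCALE 1: `1∕h(1)² = 1∕p² + 2 + 6q·(1 − √3·h(1))₊`. [folklore] -/
theorem step_one (hf : MemFlow (fun u : ℕ → ℝ => 2 + 6 * q * max (1 - Real.sqrt 3 * u 0) 0) p h) :
    1 / h 1 ^ 2 = 1 / p ^ 2 + (2 + 6 * q * max (1 - Real.sqrt 3 * h 1) 0) := by
  have h0 := hf.2 0
  simp only [zero_add, add_zero] at h0
  rw [hf.1] at h0
  exact h0

/-- THE WINDOW: `√3·h(1) ≤ 1` for a box solution from a pin `p ∈ ]0,1]` (`1∕h(1)² ≥ 1∕p² + 2 ≥ 3`). [folklore] -/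
theorem sqrt3_mul_le_one (hq : 0 ≤ q) (hp0 : 0 < p) (hp1 : p ≤ 1) (hh : SeqBox 1 h)
    (hf : MemFlow (fun u : ℕ → ℝ => 2 + 6 * q * max (1 - Real.sqrt 3 * u 0) 0) p h) : Real.sqrt 3 * h 1 ≤ 1 := by
  have h1 := step_one hf
  have ha := (hh 1).1
  have hp2 : 1 ≤ 1 / p ^ 2 := by
    rw [le_div_iff₀ (by positivity)]
    nlinarith
  have hmax : 0 ≤ 6 * q * max (1 - Real.sqrt 3 * h 1) 0 := mul_nonneg (by positivity) (le_max_right _ _)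
  have h3 : 3 ≤ 1 / h 1 ^ 2 := by linarith
  have h4 : 3 * h 1 ^ 2 ≤ 1 := by
    rw [le_div_iff₀ (by positivity)] at h3
    linarith
  have h5 : (Real.sqrt 3 * h 1) ^ 2 ≤ 1 := by
    rw [mul_pow, Real.sq_sqrt (by norm_num : (0 : ℝ) ≤ 3)]
    linarith
  nlinarith [mul_nonneg (Real.sqrt_nonneg 3) ha.le]

/-- THE SCALED STEP EQUATION: `1∕p² − 1 = 3∕(√3·h(1))² − 3 − 6q·(1 − √3·h(1))` — the forcing `P = 1∕p² − 1` against `s = √3·h(1)`. [folklore] -/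
theorem scaled_step (hq : 0 ≤ q) (hp0 : 0 < p) (hp1 : p ≤ 1) (hh : SeqBox 1 h)
    (hf : MemFlow (fun u : ℕ → ℝ => 2 + 6 * q * max (1 - Real.sqrt 3 * u 0) 0) p h) :
    1 / p ^ 2 - 1 = 3 / (Real.sqrt 3 * h 1) ^ 2 - 3 - 6 * q * (1 - Real.sqrt 3 * h 1) := by
  have h1 := step_one hf
  have hs := sqrt3_mul_le_one hq hp0 hp1 hh hf
  have ha := (hh 1).1.ne'
  rw [max_eq_left (sub_nonneg.2 hs)] at h1
  have e : 3 / (Real.sqrt 3 * h 1) ^ 2 = 1 / h 1 ^ 2 := by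
    rw [mul_pow, Real.sq_sqrt (by norm_num : (0 : ℝ) ≤ 3)]
    field_simp
  rw [e]
  linarith

/-! ## §3 Pin `1`: every box solution sits at the corner `h(1) = 1∕√3` -/

/-- **AT PIN `1` EVERY BOX SOLUTION HAS `√3·h(1) = 1`** (`0 ≤ q ≤ 1`): with `s = √3·h(1) ∈ ]0,1]` the step equation gives
`3 = (3 + 6q(1−s))·s² ≤ 9s² − 6s³`, i.e. `(s−1)²(2s+1) ≤ 0`. At `q = 1` the root `s = 1` is DOUBLE — the fold behind the `√`-modulus. [folklore] -/
theorem sqrt3_mul_eq_one_of_pin_one (hq0 : 0 ≤ q) (hq1 : q ≤ 1) (hh : SeqBox 1 h)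
    (hf : MemFlow (fun u : ℕ → ℝ => 2 + 6 * q * max (1 - Real.sqrt 3 * u 0) 0) 1 h) : Real.sqrt 3 * h 1 = 1 := by
  have hP := scaled_step hq0 one_pos le_rfl hh hf
  have hs1 := sqrt3_mul_le_one hq0 one_pos le_rfl hh hf
  set s := Real.sqrt 3 * h 1 with hs
  have hs0 : 0 < s := mul_pos (Real.sqrt_pos.2 (by norm_num)) (hh 1).1
  have e : 3 / s ^ 2 = 3 + 6 * q * (1 - s) := by
    have : (1 : ℝ) / 1 ^ 2 - 1 = 0 := by norm_num
    linarith
  have e2 : 3 = (3 + 6 * q * (1 - s)) * s ^ 2 := by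
    rw [← e]
    field_simp
  have key : (s - 1) ^ 2 * (2 * s + 1) ≤ 0 := by
    nlinarith [mul_nonneg (mul_nonneg (sub_nonneg.2 hq1) (sub_nonneg.2 hs1)) (sq_nonneg s)]
  have hsq : (s - 1) ^ 2 ≤ 0 := by
    by_contra hcon
    have := mul_pos (not_le.1 hcon) (by linarith : 0 < 2 * s + 1)
    linarith
  have h0 : (s - 1) ^ 2 = 0 := le_antisymm hsq (sq_nonneg _)
  have := pow_eq_zero_iff (n := 2) (by norm_num) |>.1 h0
  linarith

/-- … i.e. `h(1) = 1∕√3`, the corner `(1∕γ² + b)^{−1∕2}` of the scale-1 window. [folklore] -/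
theorem apply_one_eq_of_pin_one (hq0 : 0 ≤ q) (hq1 : q ≤ 1) (hh : SeqBox 1 h)
    (hf : MemFlow (fun u : ℕ → ℝ => 2 + 6 * q * max (1 - Real.sqrt 3 * u 0) 0) 1 h) : h 1 = 1 / Real.sqrt 3 := by
  have := sqrt3_mul_eq_one_of_pin_one hq0 hq1 hh hf
  rw [eq_div_iff (Real.sqrt_pos.2 (by norm_num : (0 : ℝ) < 3)).ne']
  linarith [mul_comm (Real.sqrt 3) (h 1)]

/-! ## §4 Pin `p ∈ [1∕2, 1[`: the two-sided forcing inequality -/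

/-- From `p ≥ 1∕2`: `√3·h(1) ≥ 1∕2` (`3∕s² ≤ 1∕p² + 2 + 6q ≤ 12`). [folklore] -/
theorem half_le_sqrt3_mul (hq0 : 0 ≤ q) (hq1 : q ≤ 1) (hp0 : 1 / 2 ≤ p) (hp1 : p ≤ 1) (hh : SeqBox 1 h)
    (hf : MemFlow (fun u : ℕ → ℝ => 2 + 6 * q * max (1 - Real.sqrt 3 * u 0) 0) p h) : 1 / 2 ≤ Real.sqrt 3 * h 1 := by
  have hp : 0 < p := by linarith
  have hP := scaled_step hq0 hp hp1 hh hf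
  have hs1 := sqrt3_mul_le_one hq0 hp hp1 hh hf
  set s := Real.sqrt 3 * h 1 with hs
  have hs0 : 0 < s := mul_pos (Real.sqrt_pos.2 (by norm_num)) (hh 1).1
  have hp2 : 1 / p ^ 2 ≤ 4 := by
    rw [div_le_iff₀ (by positivity)]
    nlinarith
  have hq2 : q * (1 - s) ≤ 1 := by
    have := mul_le_mul hq1 (by linarith : 1 - s ≤ 1) (sub_nonneg.2 hs1) zero_le_one
    linarith
  have h3 : 3 / s ^ 2 ≤ 12 := by linarith
  have h4 : 3 ≤ 12 * s ^ 2 := by rwa [div_le_iff₀ (by positivity)] at h3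
  nlinarith

/-- `3 = (P + 3 + 6q(1 − s))·s²` — the step equation with denominators cleared (`s = √3·h(1)`, `P = 1∕p² − 1`). [folklore] -/
theorem three_eq_mul_sq (hq0 : 0 ≤ q) (hp0 : 0 < p) (hp1 : p ≤ 1) (hh : SeqBox 1 h)
    (hf : MemFlow (fun u : ℕ → ℝ => 2 + 6 * q * max (1 - Real.sqrt 3 * u 0) 0) p h) :
    3 = (1 / p ^ 2 - 1 + 3 + 6 * q * (1 - Real.sqrt 3 * h 1)) * (Real.sqrt 3 * h 1) ^ 2 := by
  have hP := scaled_step hq0 hp0 hp1 hh hf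
  have hs0 : 0 < Real.sqrt 3 * h 1 := mul_pos (Real.sqrt_pos.2 (by norm_num)) (hh 1).1
  have ha := (hh 1).1.ne'
  have e : 3 / (Real.sqrt 3 * h 1) ^ 2 = 1 / p ^ 2 - 1 + 3 + 6 * q * (1 - Real.sqrt 3 * h 1) := by linarith
  rw [← e]
  field_simp

/-- **THE FORCING FROM BELOW**: `6(1−q)·t + 9t² ≤ 1∕p² − 1`, `t = 1 − √3·h(1)` (`3 − 3s² − (6t + 9t²)s² = 3t³(4 − 3t) ≥ 0`) — the family's own form of
(E47a)'s two-term modulus. [folklore] -/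
theorem forcing_ge (hq0 : 0 ≤ q) (hp0 : 0 < p) (hp1 : p ≤ 1) (hh : SeqBox 1 h)
    (hf : MemFlow (fun u : ℕ → ℝ => 2 + 6 * q * max (1 - Real.sqrt 3 * u 0) 0) p h) :
    6 * (1 - q) * (1 - Real.sqrt 3 * h 1) + 9 * (1 - Real.sqrt 3 * h 1) ^ 2 ≤ 1 / p ^ 2 - 1 := by
  have e := three_eq_mul_sq hq0 hp0 hp1 hh hf
  have hs1 := sqrt3_mul_le_one hq0 hp0 hp1 hh hf
  set s := Real.sqrt 3 * h 1 with hs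
  set P := 1 / p ^ 2 - 1 with hPdef
  have hs0 : 0 < s := mul_pos (Real.sqrt_pos.2 (by norm_num)) (hh 1).1
  have ht0 : 0 ≤ 1 - s := sub_nonneg.2 hs1
  have key : (6 * (1 - q) * (1 - s) + 9 * (1 - s) ^ 2) * s ^ 2 ≤ P * s ^ 2 := by
    have hP : P * s ^ 2 = 3 - 3 * s ^ 2 - 6 * q * (1 - s) * s ^ 2 := by linear_combination -e
    rw [hP]
    nlinarith [mul_nonneg (pow_nonneg ht0 3) (by linarith : (0 : ℝ) ≤ 1 + 3 * s), mul_nonneg (mul_nonneg hq0 ht0) (sq_nonneg s)]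
  exact le_of_mul_le_mul_right key (by positivity)

/-- **THE FORCING FROM ABOVE**: for `p ≥ 1∕2` (so `t ≤ 1∕2`), `1∕p² − 1 ≤ 6(1−q)·t + 33t²`, `t = 1 − √3·h(1)`
(`(6t + 33t²)s² − 3 + 3s² = t²(24 − 60t + 33t²) ≥ 0` on `[0, 1∕2]`). [folklore] -/
theorem forcing_le (hq0 : 0 ≤ q) (hq1 : q ≤ 1) (hp0 : 1 / 2 ≤ p) (hp1 : p ≤ 1) (hh : SeqBox 1 h)
    (hf : MemFlow (fun u : ℕ → ℝ => 2 + 6 * q * max (1 - Real.sqrt 3 * u 0) 0) p h) :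
    1 / p ^ 2 - 1 ≤ 6 * (1 - q) * (1 - Real.sqrt 3 * h 1) + 33 * (1 - Real.sqrt 3 * h 1) ^ 2 := by
  have hp : 0 < p := by linarith
  have e := three_eq_mul_sq hq0 hp hp1 hh hf
  have hs1 := sqrt3_mul_le_one hq0 hp hp1 hh hf
  have hs2 := half_le_sqrt3_mul hq0 hq1 hp0 hp1 hh hf
  set s := Real.sqrt 3 * h 1 with hs
  set P := 1 / p ^ 2 - 1 with hPdef
  have hs0 : 0 < s := by linarith
  have ht0 : 0 ≤ 1 - s := sub_nonneg.2 hs1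
  have ht2 : 1 - s ≤ 1 / 2 := by linarith
  have hquad : 0 ≤ 24 - 60 * (1 - s) + 33 * (1 - s) ^ 2 := by nlinarith [sq_nonneg (1 - s - 1 / 2)]
  have key : P * s ^ 2 ≤ (6 * (1 - q) * (1 - s) + 33 * (1 - s) ^ 2) * s ^ 2 := by
    have hP : P * s ^ 2 = 3 - 3 * s ^ 2 - 6 * q * (1 - s) * s ^ 2 := by linear_combination -e
    rw [hP]
    nlinarith [mul_nonneg (sq_nonneg (1 - s)) hquad, mul_nonneg (mul_nonneg hq0 ht0) (sq_nonneg s)]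
  exact le_of_mul_le_mul_right key (by positivity)

/-- THE SCALE-1 DISCREPANCY of the solutions from the pins `1` and `p`: `√3·(h(1) − h′(1)) = 1 − √3·h′(1)` (`q ≤ 1`). [folklore] -/
theorem sqrt3_mul_sub_eq (hq0 : 0 ≤ q) (hq1 : q ≤ 1) (hh : SeqBox 1 h)
    (hf : MemFlow (fun u : ℕ → ℝ => 2 + 6 * q * max (1 - Real.sqrt 3 * u 0) 0) 1 h) (h' : ℕ → ℝ) :
    Real.sqrt 3 * (h 1 - h' 1) = 1 - Real.sqrt 3 * h' 1 := by
  rw [mul_sub, sqrt3_mul_eq_one_of_pin_one hq0 hq1 hh hf]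

/-! ## §5 ENDs: the lower bounds in both regimes, and at the threshold -/

/-- **THE LIPSCHITZ REGIME IS EXACT IN ORDER**: `0 ≤ q < 1`, pins `1` and `p ∈ [1∕2,1[` with `1∕p² − 1 ≤ 9(1−q)²`, box solutions `h, h′` ⟹
`(1∕p² − 1)∕(68(1−q)) ≤ h(1) − h′(1)` — against (E38b)'s ∕ (E47a)'s `sup_j |h_j − h′_j| ≤ (1∕p² − 1)∕(2(1−q))` for this instance: the blow-up
`1∕(1−q)` of the Lipschitz constant at the threshold is genuine. (`t² ≤ P∕9 ≤ (1−q)²` ⟹ `P ≤ 39(1−q)t`; `39√3 ≤ 68`.) [folklore] -/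
theorem gap_lipschitz_regime (hq0 : 0 ≤ q) (hq1 : q < 1) (hp0 : 1 / 2 ≤ p) (hp1 : p ≤ 1)
    (hreg : 1 / p ^ 2 - 1 ≤ 9 * (1 - q) ^ 2) (hh : SeqBox 1 h)
    (hf : MemFlow (fun u : ℕ → ℝ => 2 + 6 * q * max (1 - Real.sqrt 3 * u 0) 0) 1 h) (hh' : SeqBox 1 h')
    (hf' : MemFlow (fun u : ℕ → ℝ => 2 + 6 * q * max (1 - Real.sqrt 3 * u 0) 0) p h') :
    (1 / p ^ 2 - 1) / (68 * (1 - q)) ≤ h 1 - h' 1 := by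
  have hp : 0 < p := by linarith
  have hlo := forcing_ge hq0 hp hp1 hh' hf'
  have hup := forcing_le hq0 hq1.le hp0 hp1 hh' hf'
  have hd := sqrt3_mul_sub_eq hq0 hq1.le hh hf h'
  have hs1 := sqrt3_mul_le_one hq0 hp hp1 hh' hf'
  set t := 1 - Real.sqrt 3 * h' 1 with ht
  set P := 1 / p ^ 2 - 1 with hPdef
  have ht0 : 0 ≤ t := sub_nonneg.2 hs1
  have h1q : 0 < 1 - q := sub_pos.2 hq1
  -- `t ≤ 1 − q`
  have htq : t ≤ 1 - q := by
    have : t ^ 2 ≤ (1 - q) ^ 2 := by nlinarith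
    exact (pow_le_pow_iff_left₀ ht0 h1q.le two_ne_zero).1 this
  -- `P ≤ 39(1−q)·t`
  have hP : P ≤ 39 * (1 - q) * t := by nlinarith [mul_le_mul_of_nonneg_left htq (by positivity : (0 : ℝ) ≤ 33 * t)]
  have h3 : (39 : ℝ) * Real.sqrt 3 ≤ 68 := by nlinarith [Real.sq_sqrt (by norm_num : (0 : ℝ) ≤ 3), Real.sqrt_nonneg 3]
  rw [div_le_iff₀ (by positivity)]
  have hd0 : 0 ≤ h 1 - h' 1 := by nlinarith [Real.sqrt_pos.2 (by norm_num : (0 : ℝ) < 3)]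
  calc P ≤ 39 * (1 - q) * t := hP
    _ = 39 * Real.sqrt 3 * (1 - q) * (h 1 - h' 1) := by rw [← hd]; ring
    _ ≤ 68 * (1 - q) * (h 1 - h' 1) := by nlinarith [mul_nonneg h1q.le hd0]
    _ = (h 1 - h' 1) * (68 * (1 - q)) := by ring

/-- **THE HÖLDER REGIME IS EXACT IN ORDER**: `0 ≤ q ≤ 1`, pins `1` and `p ∈ [1∕2,1[` with `9(1−q)² ≤ 1∕p² − 1`, box solutions `h, h′` ⟹
`√(1∕p² − 1)∕20 ≤ h(1) − h′(1)` — against (E47a)'s `sup_j |h_j − h′_j| ≤ √((1∕p² − 1)∕(2q))` for this instance.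
(`r = √P ≥ 3(1−q)`, `r² ≤ 2rt + 33t²` ⟹ `r ≤ 11t`; `11√3 ≤ 20`.) [folklore] -/
theorem gap_hoelder_regime (hq0 : 0 ≤ q) (hq1 : q ≤ 1) (hp0 : 1 / 2 ≤ p) (hp1 : p ≤ 1)
    (hreg : 9 * (1 - q) ^ 2 ≤ 1 / p ^ 2 - 1) (hh : SeqBox 1 h)
    (hf : MemFlow (fun u : ℕ → ℝ => 2 + 6 * q * max (1 - Real.sqrt 3 * u 0) 0) 1 h) (hh' : SeqBox 1 h')
    (hf' : MemFlow (fun u : ℕ → ℝ => 2 + 6 * q * max (1 - Real.sqrt 3 * u 0) 0) p h') :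
    Real.sqrt (1 / p ^ 2 - 1) / 20 ≤ h 1 - h' 1 := by
  have hp : 0 < p := by linarith
  have hup := forcing_le hq0 hq1 hp0 hp1 hh' hf'
  have hd := sqrt3_mul_sub_eq hq0 hq1 hh hf h'
  have hs1 := sqrt3_mul_le_one hq0 hp hp1 hh' hf'
  set t := 1 - Real.sqrt 3 * h' 1 with ht
  set P := 1 / p ^ 2 - 1 with hPdef
  have ht0 : 0 ≤ t := sub_nonneg.2 hs1
  have hP0 : 0 ≤ P := (by positivity : (0 : ℝ) ≤ 9 * (1 - q) ^ 2).trans hreg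
  set r := Real.sqrt P with hr
  have hr0 : 0 ≤ r := Real.sqrt_nonneg _
  have hr2 : r ^ 2 = P := Real.sq_sqrt hP0
  have hqr : 3 * (1 - q) ≤ r := by
    rw [hr, show 3 * (1 - q) = Real.sqrt ((3 * (1 - q)) ^ 2) by rw [Real.sqrt_sq (by linarith)]]
    exact Real.sqrt_le_sqrt (by nlinarith)
  -- `r ≤ 11·t`
  have hrt : r ≤ 11 * t := by
    by_contra hcon
    push Not at hcon
    have hr' : 0 < r := lt_of_le_of_lt (by positivity) hcon
    nlinarith [mul_le_mul_of_nonneg_right hqr ht0, mul_lt_mul_of_pos_left hcon hr']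
  have h3 : (11 : ℝ) * Real.sqrt 3 ≤ 20 := by nlinarith [Real.sq_sqrt (by norm_num : (0 : ℝ) ≤ 3), Real.sqrt_nonneg 3]
  have hd0 : 0 ≤ h 1 - h' 1 := by nlinarith [Real.sqrt_pos.2 (by norm_num : (0 : ℝ) < 3)]
  rw [div_le_iff₀ (by norm_num : (0 : ℝ) < 20)]
  calc r ≤ 11 * t := hrt
    _ = 11 * Real.sqrt 3 * (h 1 - h' 1) := by rw [← hd]; ring
    _ ≤ 20 * (h 1 - h' 1) := by nlinarith
    _ = (h 1 - h' 1) * 20 := by ring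

/-- **EXPONENT `1∕2` IS EXACT AT THE THRESHOLD** (`q = 1`, `M·γ = 3√3·b`): pins `1` and `p ∈ [1∕2,1[`, box solutions `h, h′` of `κ_1` ⟹
`√(1∕p² − 1)∕10 ≤ h(1) − h′(1)` — against (E47a)'s `sup_j |h_j − h′_j| ≤ √(γ·F) = √((1∕p² − 1)∕2)` for this instance. (`P ≤ 33t²`, `3·33 ≤ 100`.) [folklore] -/
theorem gap_at_threshold (hp0 : 1 / 2 ≤ p) (hp1 : p ≤ 1) (hh : SeqBox 1 h)
    (hf : MemFlow (fun u : ℕ → ℝ => 2 + 6 * 1 * max (1 - Real.sqrt 3 * u 0) 0) 1 h) (hh' : SeqBox 1 h')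
    (hf' : MemFlow (fun u : ℕ → ℝ => 2 + 6 * 1 * max (1 - Real.sqrt 3 * u 0) 0) p h') :
    Real.sqrt (1 / p ^ 2 - 1) / 10 ≤ h 1 - h' 1 := by
  have hp : 0 < p := by linarith
  have hup := forcing_le (q := 1) zero_le_one le_rfl hp0 hp1 hh' hf'
  have hd := sqrt3_mul_sub_eq (q := 1) zero_le_one le_rfl hh hf h'
  have hs1 := sqrt3_mul_le_one (q := 1) zero_le_one hp hp1 hh' hf'
  set t := 1 - Real.sqrt 3 * h' 1 with ht
  set P := 1 / p ^ 2 - 1 with hPdef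
  have ht0 : 0 ≤ t := sub_nonneg.2 hs1
  have hP : P ≤ 33 * t ^ 2 := by linarith
  have h33 : 3 * P ≤ 100 * t ^ 2 := by nlinarith [sq_nonneg t]
  have hd0 : 0 ≤ h 1 - h' 1 := by nlinarith [Real.sqrt_pos.2 (by norm_num : (0 : ℝ) < 3)]
  -- `√3·√P ≤ 10·t = 10·√3·(h 1 − h′ 1)`
  have hsq : Real.sqrt 3 * Real.sqrt P ≤ 10 * t := by
    rw [← Real.sqrt_mul (by norm_num : (0 : ℝ) ≤ 3),
      show 10 * t = Real.sqrt ((10 * t) ^ 2) by rw [Real.sqrt_sq (by positivity)]]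
    exact Real.sqrt_le_sqrt (by nlinarith)
  rw [div_le_iff₀ (by norm_num : (0 : ℝ) < 10)]
  have h3 : (0 : ℝ) < Real.sqrt 3 := Real.sqrt_pos.2 (by norm_num)
  have : Real.sqrt 3 * Real.sqrt P ≤ Real.sqrt 3 * ((h 1 - h' 1) * 10) := by
    calc Real.sqrt 3 * Real.sqrt P ≤ 10 * t := hsq
      _ = Real.sqrt 3 * ((h 1 - h' 1) * 10) := by rw [← hd]; ring
  exact le_of_mul_le_mul_left this h3

/-- THE PIN OF A PRESCRIBED FORCING: for `0 < P ≤ 3`, `p = 1∕√(1+P)` lies in `[1∕2, 1[` and `1∕p² − 1 = P`. [folklore] -/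
theorem pin_of_forcing {P : ℝ} (hP0 : 0 < P) (hP3 : P ≤ 3) :
    1 / 2 ≤ 1 / Real.sqrt (1 + P) ∧ 1 / Real.sqrt (1 + P) < 1 ∧ 1 / (1 / Real.sqrt (1 + P)) ^ 2 - 1 = P := by
  have h1 : 0 < Real.sqrt (1 + P) := Real.sqrt_pos.2 (by linarith)
  refine ⟨?_, ?_, ?_⟩
  · rw [le_div_iff₀ h1, show Real.sqrt (1 + P) = Real.sqrt (1 + P) by rfl]
    have : Real.sqrt (1 + P) ≤ 2 := by
      rw [show (2 : ℝ) = Real.sqrt (2 ^ 2) by rw [Real.sqrt_sq (by norm_num)]]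
      exact Real.sqrt_le_sqrt (by linarith)
    linarith
  · rw [div_lt_one h1]
    exact (Real.lt_sqrt zero_le_one).2 (by nlinarith)
  · rw [div_pow, one_pow, Real.sq_sqrt (by linarith : (0 : ℝ) ≤ 1 + P), one_div_one_div]
    ring

/-- **NO LIPSCHITZ MODULUS AT THE THRESHOLD**: for every `L` there are a pin `p ∈ [1∕2, 1[` and box solutions `h, h′` of `κ_1` from the pins `1, p`
(they exist, (E40)) with `h(1) − h′(1) > L·(1∕p² − 1)` — (E38b)'s `1∕(1 − q)` is genuinely infinite at `q = 1`. [folklore] -/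
theorem not_lipschitz_at_threshold (L : ℝ) :
    ∃ p : ℝ, 1 / 2 ≤ p ∧ p < 1 ∧ ∃ h h' : ℕ → ℝ,
      SeqBox 1 h ∧ MemFlow (fun u : ℕ → ℝ => 2 + 6 * 1 * max (1 - Real.sqrt 3 * u 0) 0) 1 h ∧
      SeqBox 1 h' ∧ MemFlow (fun u : ℕ → ℝ => 2 + 6 * 1 * max (1 - Real.sqrt 3 * u 0) 0) p h' ∧
      L * (1 / p ^ 2 - 1) < h 1 - h' 1 := by
  -- a forcing `P ∈ ]0,3]` with `L·P < √P∕10`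
  obtain ⟨P, hP0, hP3, hLP⟩ : ∃ P : ℝ, 0 < P ∧ P ≤ 3 ∧ L * P < Real.sqrt P / 10 := by
    rcases le_or_gt L 0 with hL | hL
    · refine ⟨3, by norm_num, le_rfl, ?_⟩
      have h1 : L * 3 ≤ 0 := by nlinarith
      have h2 : 0 < Real.sqrt 3 / 10 := by positivity
      linarith
    · refine ⟨min 3 (1 / (200 * L ^ 2)), lt_min (by norm_num) (by positivity), min_le_left _ _, ?_⟩
      set P := min 3 (1 / (200 * L ^ 2)) with hPdef
      have hP0 : 0 < P := lt_min (by norm_num) (by positivity)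
      have hPle : P ≤ 1 / (200 * L ^ 2) := min_le_right _ _
      have h1 : P * (200 * L ^ 2) ≤ 1 := (le_div_iff₀ (by positivity)).1 hPle
      -- `(10·L·P)² = 100 L² P · P < P = (√P)²`
      have h2 : (10 * (L * P)) ^ 2 < Real.sqrt P ^ 2 := by
        rw [Real.sq_sqrt hP0.le]
        nlinarith [mul_pos hP0 hP0, mul_pos hL hP0]
      have h3 : 10 * (L * P) < Real.sqrt P := lt_of_pow_lt_pow_left₀ 2 (Real.sqrt_nonneg P) h2
      linarith
  obtain ⟨hp0, hp1, hpP⟩ := pin_of_forcing hP0 hP3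
  set p := 1 / Real.sqrt (1 + P) with hpdef
  obtain ⟨h, hh, hf⟩ := exists_solution (q := 1) zero_le_one one_pos le_rfl
  obtain ⟨h', hh', hf'⟩ := exists_solution (q := 1) zero_le_one (by linarith) hp1.le
  refine ⟨p, hp0, hp1, h, h', hh, hf, hh', hf', ?_⟩
  have hgap := gap_at_threshold hp0 hp1.le hh hf hh' hf'
  rw [hpP] at hgap ⊢
  exact hLP.trans_le hgap

end Summit.QuantumFields.BalabanUV.Beta.EriceRemainderEnclosureHistoryAutonomyThresholdModulusWitness

end
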